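import Literature.Topology.FourManifolds.KhBigon
import Literature.Topology.FourManifolds.KhCurlArcs
import Literature.Topology.FourManifolds.KhSurgeryStates
import HarnessLib

/-!
# The oriented resolution of the bigon is the old diagram

Sibling file of `KhComplex.lean`, continuing `KhBigon` in the invariance programme for
`Literature.Topology.FourManifolds.GaussDiagram.nonempty_iso_khovanovHomology_of_equiv`
(Khovanov (2000), Thm. 1; second Reidemeister move, §5.3). In the resolution `stD σ` of the
bigon `G.bigon m tf ε` in which both new chords are smoothed à la Seifert (the positive one at
`0`, the negative one at `1`), the two strands run straight through the bigon: every state circle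
of `stD σ` is a state circle of `σ` with two arcs subdivided. This file makes the identification
`C(D_{01}) = C(D)` of Khovanov (2000), §5.3 / Bar-Natan (2002), §4.3 explicit on generators:

* `projD`, `liftD` — the projection of the arcs of the bigon onto the arcs of `G` adapted to the
  oriented resolution (each side of the bigon goes with the strand it lies on) and a section;
  `circleOf_stD_eq_iff` — **two arcs lie on one circle of `stD σ` iff their projections lie on
  one circle of `σ`**;
* `bigonD s` — the enhanced state of the bigon over `stD s.state` with the labels of `s`;
  `eq_bigonD_of_state_eq` — every enhanced state over an oriented resolution is of this form;
* `incidence_bigonD` — **the differential restricted to the oriented resolutions is the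
  differential of `G`**: `⟨d (bigonD s), bigonD s'⟩ = ⟨d s, s'⟩` (merges, splits, labels and
  Koszul signs correspond);
* `homDegree_bigonD`, `qDegree_bigonD` — the bidegree is unchanged (`|s| + 1`, `n₊ + 1`,
  `n₋ + 1`).

No named fact is introduced.

## References

* M. Khovanov, *A categorification of the Jones polynomial*, Duke Math. J. 101 (2000) 359–426,
  §5.3. [cite: Khovanov2000, §5.3]
* D. Bar-Natan, *On Khovanov's categorification of the Jones polynomial*, Algebr. Geom. Topol. 2
  (2002) 337–370, §4.3. [cite: BarNatan2002, §4]
-/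

open Function

noncomputable section

namespace Literature.Topology.FourManifolds

namespace GaussDiagram

variable (G : GaussDiagram) (m : Fin (2 * G.n + 1)) (tf : Bool) (ε : ℤˣ)

/-! ## The projection of arcs adapted to the oriented resolution -/

/-- The old arc subdivided by the pair of new points `m, m + 1`: arc number `m - 1`, cyclically
(`baseArc`, number `2n - 1`, for `m = 0`). [folklore] -/
def midArc : G.Arc :=
  ⟨if m.val = 0 then 2 * G.n - 1 else m.val - 1, by unfold arcCount; have := m.isLt; split_ifs <;> omega⟩

/-- The value of `midArc`. [folklore] -/
@[simp] theorem val_midArc : (G.midArc m : ℕ) = if m.val = 0 then 2 * G.n - 1 else m.val - 1 := rfl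

/-- The number of the old arc onto which the arc number `j` of the bigon projects in the oriented
resolution: old arcs keep (up to the shift) their numbers, the first side `m ↦ 2n - 1` goes with
the strand through `2n + 2, 2n + 3`, the second side `2n + 2 ↦ m - 1` with the strand through
`m, m + 1`. [folklore] -/
def projDVal (j : ℕ) : ℕ :=
  if j < m.val then j
  else if j = m.val then 2 * G.n - 1
  else if j = m.val + 1 then (if m.val = 0 then 2 * G.n - 1 else m.val - 1)
  else if j ≤ 2 * G.n + 1 then j - 2
  else if j = 2 * G.n + 2 then (if m.val = 0 then 2 * G.n - 1 else m.val - 1)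
  else 2 * G.n - 1

/-- `projDVal` lands in the old arcs. [folklore] -/
theorem projDVal_lt (j : ℕ) : G.projDVal m j < G.arcCount := by
  unfold projDVal arcCount
  have := m.isLt
  split_ifs <;> omega

/-- **The projection of the arcs of the bigon onto the arcs of `G`** adapted to the oriented
resolution. [folklore] -/
def projD (x : (G.bigon m tf ε).Arc) : G.Arc := ⟨G.projDVal m x.val, G.projDVal_lt m x.val⟩

/-- The value of the projection. [folklore] -/
@[simp] theorem val_projD (x : (G.bigon m tf ε).Arc) : (G.projD m tf ε x : ℕ) = G.projDVal m x.val :=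
  rfl

/-- **A section of the projection**: the old arc `q` lifts to the arc leaving the embedded old
point `q`. [folklore] -/
def liftD (a : G.Arc) : (G.bigon m tf ε).Arc :=
  ⟨if a.val < m.val then a.val else a.val + 2, by
    have ha := a.isLt
    unfold arcCount at *
    rw [bigon_n]
    split_ifs <;> omega⟩

/-- The value of the lift. [folklore] -/
@[simp] theorem val_liftD (a : G.Arc) :
    (G.liftD m tf ε a : ℕ) = if a.val < m.val then a.val else a.val + 2 := rfl

/-- The lift is a section of the projection. [folklore] -/
@[simp] theorem projD_liftD (a : G.Arc) : G.projD m tf ε (G.liftD m tf ε a) = a := by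
  apply Fin.ext
  have ha := a.isLt
  unfold arcCount at ha
  have hm := m.isLt
  simp only [val_projD, val_liftD, projDVal]
  split_ifs <;> omega

/-- The first side projects to `baseArc`. [folklore] -/
@[simp] theorem projD_sideM : G.projD m tf ε (G.sideM m tf ε) = G.baseArc := by
  apply Fin.ext; have hm := m.isLt; simp only [val_projD, val_sideM, projDVal, val_baseArc]
  split_ifs <;> omega

/-- The second side projects to `midArc`. [folklore] -/
@[simp] theorem projD_sideE : G.projD m tf ε (G.sideE m tf ε) = G.midArc m := by
  apply Fin.ext; have hm := m.isLt; simp only [val_projD, val_sideE, projDVal, val_midArc]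
  split_ifs <;> omega

/-- The arc leaving `m + 1` projects to `midArc`. [folklore] -/
@[simp] theorem projD_outM1 : G.projD m tf ε (G.outM1 m tf ε) = G.midArc m := by
  apply Fin.ext; have hm := m.isLt; simp only [val_projD, val_outM1, projDVal, val_midArc]
  split_ifs <;> omega

/-- The arc leaving `2n + 3` projects to `baseArc`. [folklore] -/
@[simp] theorem projD_outE1 : G.projD m tf ε (G.outE1 m tf ε) = G.baseArc := by
  apply Fin.ext; have hm := m.isLt; simp only [val_projD, val_outE1, projDVal, val_baseArc]
  split_ifs <;> omega

/-- The arc entering `m` projects to `midArc`. [folklore] -/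
@[simp] theorem projD_inM : G.projD m tf ε (G.inM m tf ε) = G.midArc m := by
  apply Fin.ext; have hm := m.isLt; simp only [val_projD, val_inM, projDVal, val_midArc]
  split_ifs <;> omega

/-- The arc entering `2n + 2` projects to `baseArc`. [folklore] -/
@[simp] theorem projD_inE : G.projD m tf ε (G.inE m tf ε) = G.baseArc := by
  apply Fin.ext; have hm := m.isLt; simp only [val_projD, val_inE, projDVal, val_baseArc]
  split_ifs <;> omega

/-- The arc leaving an embedded old point projects to the old outgoing arc. [folklore] -/
@[simp] theorem projD_arcOut_bEmb (q : Fin (2 * G.n)) :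
    G.projD m tf ε ((G.bigon m tf ε).arcOut (G.bEmb m tf ε q)) = G.arcOut q := by
  apply Fin.ext
  have hm := m.isLt; have hq := q.isLt
  rw [val_projD, val_arcOut_bEmb, arcOut_val]
  unfold projDVal
  split_ifs <;> omega

/-- The arc entering an embedded old point projects to the old incoming arc. [folklore] -/
@[simp] theorem projD_arcIn_bEmb (q : Fin (2 * G.n)) :
    G.projD m tf ε ((G.bigon m tf ε).arcIn (G.bEmb m tf ε q)) = G.arcIn q := by
  apply Fin.ext
  have hm := m.isLt; have hq := q.isLt
  rw [val_projD, val_arcIn_bEmb, arcIn_val]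
  unfold projDVal
  split_ifs <;> omega

/-- The lift of the old outgoing arc is the arc leaving the embedded old point. [folklore] -/
theorem liftD_arcOut (q : Fin (2 * G.n)) :
    G.liftD m tf ε (G.arcOut q) = (G.bigon m tf ε).arcOut (G.bEmb m tf ε q) :=
  Fin.ext rfl

/-! ## Gluings of the bigon at old points, projected -/

section Glue

variable (σ : G.State) (a b : Bool)

/-- The gluing clause of the bigon at an embedded old point. [folklore] -/
theorem glueRel_bigon_bEmb (q : Fin (2 * G.n)) (u v : (G.bigon m tf ε).Arc) :
    (G.bigon m tf ε).glueRel (G.bigonState m tf ε σ a b) (G.bEmb m tf ε q) u v ↔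
      (G.isSeifert σ (G.chordOf q) = true ∧
          ((u = (G.bigon m tf ε).arcIn (G.bEmb m tf ε q) ∧
              v = (G.bigon m tf ε).arcOut (G.bEmb m tf ε (G.partner q))) ∨
            (v = (G.bigon m tf ε).arcIn (G.bEmb m tf ε q) ∧
              u = (G.bigon m tf ε).arcOut (G.bEmb m tf ε (G.partner q))))) ∨
        (G.isSeifert σ (G.chordOf q) = false ∧
          ((u = (G.bigon m tf ε).arcIn (G.bEmb m tf ε q) ∧
              v = (G.bigon m tf ε).arcIn (G.bEmb m tf ε (G.partner q))) ∨
            (u = (G.bigon m tf ε).arcOut (G.bEmb m tf ε q) ∧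
              v = (G.bigon m tf ε).arcOut (G.bEmb m tf ε (G.partner q))))) := by
  simp only [glueRel, chordOf_bEmb, isSeifert_bigon_oldC, partner_bEmb]

/-- A gluing of the bigon at an old point projects to the corresponding gluing of `G`.
[folklore] -/
theorem glueRel_projD_of_bEmb {q : Fin (2 * G.n)} {u v : (G.bigon m tf ε).Arc}
    (h : (G.bigon m tf ε).glueRel (G.bigonState m tf ε σ a b) (G.bEmb m tf ε q) u v) :
    G.glueRel σ q (G.projD m tf ε u) (G.projD m tf ε v) := by
  rw [glueRel_bigon_bEmb] at h
  unfold glueRel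
  rcases h with ⟨hs, ⟨rfl, rfl⟩ | ⟨rfl, rfl⟩⟩ | ⟨hs, ⟨rfl, rfl⟩ | ⟨rfl, rfl⟩⟩ <;> simp [hs]

/-- A gluing of `G` lifts to a gluing of the bigon at the corresponding old point, between arcs
with the given projections. [folklore] -/
theorem exists_glueRel_bigon_of_glueRel {q : Fin (2 * G.n)} {u₀ v₀ : G.Arc}
    (h : G.glueRel σ q u₀ v₀) :
    ∃ u v, (G.bigon m tf ε).glueRel (G.bigonState m tf ε σ a b) (G.bEmb m tf ε q) u v ∧
      G.projD m tf ε u = u₀ ∧ G.projD m tf ε v = v₀ := by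
  unfold glueRel at h
  rcases h with ⟨hs, ⟨rfl, rfl⟩ | ⟨rfl, rfl⟩⟩ | ⟨hs, ⟨rfl, rfl⟩ | ⟨rfl, rfl⟩⟩
  · exact ⟨_, _, (G.glueRel_bigon_bEmb m tf ε σ a b q _ _).2 (Or.inl ⟨hs, Or.inl ⟨rfl, rfl⟩⟩),
      by simp, by simp⟩
  · exact ⟨_, _, (G.glueRel_bigon_bEmb m tf ε σ a b q _ _).2 (Or.inl ⟨hs, Or.inr ⟨rfl, rfl⟩⟩),
      by simp, by simp⟩
  · exact ⟨_, _, (G.glueRel_bigon_bEmb m tf ε σ a b q _ _).2 (Or.inr ⟨hs, Or.inl ⟨rfl, rfl⟩⟩),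
      by simp, by simp⟩
  · exact ⟨_, _, (G.glueRel_bigon_bEmb m tf ε σ a b q _ _).2 (Or.inr ⟨hs, Or.inr ⟨rfl, rfl⟩⟩),
      by simp, by simp⟩

end Glue

/-! ## Reachability in the oriented resolution -/

section Reach

variable (σ : G.State)

/-- In the oriented resolution, a gluing at a new point relates two arcs with the same
projection (both sides of the bigon go with the strand they are glued into). [folklore] -/
theorem projD_eq_of_glueRel_stD_new {p : Fin (2 * (G.bigon m tf ε).n)}
    (hp : p = G.posM m tf ε ∨ p = G.posM1 m tf ε ∨ p = G.posE m tf ε ∨ p = G.posE1 m tf ε)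
    {u v : (G.bigon m tf ε).Arc} (h : (G.bigon m tf ε).glueRel (G.stD m tf ε σ) p u v) :
    G.projD m tf ε u = G.projD m tf ε v := by
  have hx := G.isSeifert_stD_bX m tf ε σ
  have hy := G.isSeifert_stD_bY m tf ε σ
  rcases hp with rfl | rfl | rfl | rfl
  · rw [glueRel_posM, hx] at h
    rcases h with ⟨-, ⟨rfl, rfl⟩ | ⟨rfl, rfl⟩⟩ | ⟨h', -⟩
    · rw [projD_inM, projD_sideE]
    · rw [projD_inM, projD_sideE]
    · exact Bool.noConfusion h'
  · rw [glueRel_posM1, hy] at h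
    rcases h with ⟨-, ⟨rfl, rfl⟩ | ⟨rfl, rfl⟩⟩ | ⟨h', -⟩
    · rw [projD_sideM, projD_outE1]
    · rw [projD_sideM, projD_outE1]
    · exact Bool.noConfusion h'
  · rw [glueRel_posE, hx] at h
    rcases h with ⟨-, ⟨rfl, rfl⟩ | ⟨rfl, rfl⟩⟩ | ⟨h', -⟩
    · rw [projD_inE, projD_sideM]
    · rw [projD_inE, projD_sideM]
    · exact Bool.noConfusion h'
  · rw [glueRel_posE1, hy] at h
    rcases h with ⟨-, ⟨rfl, rfl⟩ | ⟨rfl, rfl⟩⟩ | ⟨h', -⟩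
    · rw [projD_sideE, projD_outM1]
    · rw [projD_sideE, projD_outM1]
    · exact Bool.noConfusion h'

/-- **Reachability in the oriented resolution of the bigon projects to reachability in `G`.**
[folklore] -/
theorem reachable_projD_stD {u v : (G.bigon m tf ε).Arc}
    (h : ((G.bigon m tf ε).stateGraph (G.stD m tf ε σ)).Reachable u v) :
    (G.stateGraph σ).Reachable (G.projD m tf ε u) (G.projD m tf ε v) := by
  obtain ⟨w⟩ := h
  induction w with
  | nil => rfl
  | @cons a c _ hadj _ ih =>
    refine SimpleGraph.Reachable.trans ?_ ih
    rw [stateGraph_adj] at hadj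
    obtain ⟨-, p, hp⟩ := hadj
    rcases G.eq_bEmb_or m tf ε p with ⟨q, rfl⟩ | hnew
    · rcases hp with hp | hp
      · exact G.reachable_of_glueRel σ (G.glueRel_projD_of_bEmb m tf ε σ _ _ hp)
      · exact (G.reachable_of_glueRel σ (G.glueRel_projD_of_bEmb m tf ε σ _ _ hp)).symm
    · rcases hp with hp | hp
      · rw [G.projD_eq_of_glueRel_stD_new m tf ε σ hnew hp]
      · rw [G.projD_eq_of_glueRel_stD_new m tf ε σ hnew hp]

/-- In the oriented resolution the arc entering `m` is glued to the second side. [folklore] -/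
theorem adj_stD_inM_sideE :
    ((G.bigon m tf ε).stateGraph (G.stD m tf ε σ)).Reachable (G.inM m tf ε) (G.sideE m tf ε) :=
  (G.bigon m tf ε).reachable_of_glueRel _ ((G.glueRel_posM m tf ε _ _ _).2
    (Or.inl ⟨G.isSeifert_stD_bX m tf ε σ, Or.inl ⟨rfl, rfl⟩⟩))

/-- In the oriented resolution the second side is glued to the arc leaving `m + 1`. [folklore] -/
theorem adj_stD_sideE_outM1 :
    ((G.bigon m tf ε).stateGraph (G.stD m tf ε σ)).Reachable (G.sideE m tf ε) (G.outM1 m tf ε) :=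
  (G.bigon m tf ε).reachable_of_glueRel _ ((G.glueRel_posE1 m tf ε _ _ _).2
    (Or.inl ⟨G.isSeifert_stD_bY m tf ε σ, Or.inl ⟨rfl, rfl⟩⟩))

/-- In the oriented resolution the arc entering `2n + 2` is glued to the first side. [folklore] -/
theorem adj_stD_inE_sideM :
    ((G.bigon m tf ε).stateGraph (G.stD m tf ε σ)).Reachable (G.inE m tf ε) (G.sideM m tf ε) :=
  (G.bigon m tf ε).reachable_of_glueRel _ ((G.glueRel_posE m tf ε _ _ _).2
    (Or.inl ⟨G.isSeifert_stD_bX m tf ε σ, Or.inl ⟨rfl, rfl⟩⟩))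

/-- In the oriented resolution the first side is glued to the arc leaving `2n + 3`. [folklore] -/
theorem adj_stD_sideM_outE1 :
    ((G.bigon m tf ε).stateGraph (G.stD m tf ε σ)).Reachable (G.sideM m tf ε) (G.outE1 m tf ε) :=
  (G.bigon m tf ε).reachable_of_glueRel _ ((G.glueRel_posM1 m tf ε _ _ _).2
    (Or.inl ⟨G.isSeifert_stD_bY m tf ε σ, Or.inl ⟨rfl, rfl⟩⟩))

/-- The fibres of the projection, on numbers: two arcs with the same projection are equal, or
both among `{inM, sideE, outM1}` (the subdivided middle arc), or both among
`{inE, sideM, outE1}` (the subdivided last arc), or all of these when the two pairs of new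
points subdivide the same old arc (`m = 0` or `m = 2n`). [folklore] -/
theorem projDVal_eq_imp {j j' : ℕ} (hj : j < 2 * G.n + 4) (hj' : j' < 2 * G.n + 4)
    (h : G.projDVal m j = G.projDVal m j') :
    j = j' ∨
      ((j = (if m.val = 0 then 2 * G.n + 3 else m.val - 1) ∨ j = 2 * G.n + 2 ∨ j = m.val + 1) ∧
        (j' = (if m.val = 0 then 2 * G.n + 3 else m.val - 1) ∨ j' = 2 * G.n + 2 ∨ j' = m.val + 1)) ∨
      ((j = 2 * G.n + 1 ∨ j = m.val ∨ j = 2 * G.n + 3) ∧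
        (j' = 2 * G.n + 1 ∨ j' = m.val ∨ j' = 2 * G.n + 3)) ∨
      ((m.val = 0 ∨ m.val = 2 * G.n) ∧
        (j = 2 * G.n + 1 ∨ j = m.val ∨ j = 2 * G.n + 3 ∨ j = 2 * G.n + 2 ∨ j = m.val + 1 ∨
          j = (if m.val = 0 then 2 * G.n + 3 else m.val - 1)) ∧
        (j' = 2 * G.n + 1 ∨ j' = m.val ∨ j' = 2 * G.n + 3 ∨ j' = 2 * G.n + 2 ∨ j' = m.val + 1 ∨
          j' = (if m.val = 0 then 2 * G.n + 3 else m.val - 1))) := by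
  have hm := m.isLt
  unfold projDVal at h
  split_ifs at h ⊢ <;> omega

/-- An arc among `{inM, sideE, outM1}` lies on the circle of the second side. [folklore] -/
theorem reachable_stD_sideE_of_val {u : (G.bigon m tf ε).Arc}
    (hu : u.val = (if m.val = 0 then 2 * G.n + 3 else m.val - 1) ∨ u.val = 2 * G.n + 2 ∨
      u.val = m.val + 1) :
    ((G.bigon m tf ε).stateGraph (G.stD m tf ε σ)).Reachable u (G.sideE m tf ε) := by
  rcases hu with hu | hu | hu
  · rw [show u = G.inM m tf ε from Fin.ext (by rw [hu, val_inM])]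
    exact G.adj_stD_inM_sideE m tf ε σ
  · rw [show u = G.sideE m tf ε from Fin.ext hu]
  · rw [show u = G.outM1 m tf ε from Fin.ext hu]
    exact (G.adj_stD_sideE_outM1 m tf ε σ).symm

/-- An arc among `{inE, sideM, outE1}` lies on the circle of the first side. [folklore] -/
theorem reachable_stD_sideM_of_val {u : (G.bigon m tf ε).Arc}
    (hu : u.val = 2 * G.n + 1 ∨ u.val = m.val ∨ u.val = 2 * G.n + 3) :
    ((G.bigon m tf ε).stateGraph (G.stD m tf ε σ)).Reachable u (G.sideM m tf ε) := by
  rcases hu with hu | hu | hu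
  · rw [show u = G.inE m tf ε from Fin.ext (by rw [hu, val_inE])]
    exact G.adj_stD_inE_sideM m tf ε σ
  · rw [show u = G.sideM m tf ε from Fin.ext hu]
  · rw [show u = G.outE1 m tf ε from Fin.ext hu]
    exact (G.adj_stD_sideM_outE1 m tf ε σ).symm

/-- When both pairs of new points subdivide the same old arc, the two sides lie on one circle of
the oriented resolution. [folklore] -/
theorem reachable_stD_sideM_sideE (hm : m.val = 0 ∨ m.val = 2 * G.n) :
    ((G.bigon m tf ε).stateGraph (G.stD m tf ε σ)).Reachable (G.sideM m tf ε) (G.sideE m tf ε) := by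
  rcases hm with hm | hm
  · -- `m = 0`: the arc leaving `2n + 3` is the arc entering `m`
    have e : G.outE1 m tf ε = G.inM m tf ε := Fin.ext (by rw [val_outE1, val_inM, if_pos hm])
    have h1 := G.adj_stD_sideM_outE1 m tf ε σ
    rw [e] at h1
    exact h1.trans (G.adj_stD_inM_sideE m tf ε σ)
  · -- `m = 2n`: the arc leaving `m + 1` is the arc entering `2n + 2`
    have e : G.outM1 m tf ε = G.inE m tf ε := Fin.ext (by rw [val_outM1, val_inE, hm])
    have h1 := G.adj_stD_sideE_outM1 m tf ε σ
    rw [e] at h1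
    exact (h1.trans (G.adj_stD_inE_sideM m tf ε σ)).symm

/-- **Arcs with the same projection lie on one circle of the oriented resolution.** [folklore] -/
theorem reachable_stD_of_projD_eq {u v : (G.bigon m tf ε).Arc}
    (h : G.projD m tf ε u = G.projD m tf ε v) :
    ((G.bigon m tf ε).stateGraph (G.stD m tf ε σ)).Reachable u v := by
  have hu : u.val < 2 * G.n + 4 := lt_of_lt_of_eq u.isLt (G.arcCount_bigon m tf ε)
  have hv : v.val < 2 * G.n + 4 := lt_of_lt_of_eq v.isLt (G.arcCount_bigon m tf ε)
  rcases G.projDVal_eq_imp m hu hv (congrArg Fin.val h) with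
    huv | ⟨hu', hv'⟩ | ⟨hu', hv'⟩ | ⟨hm, hu', hv'⟩
  · rw [Fin.ext huv]
  · exact (G.reachable_stD_sideE_of_val m tf ε σ hu').trans
      (G.reachable_stD_sideE_of_val m tf ε σ hv').symm
  · exact (G.reachable_stD_sideM_of_val m tf ε σ hu').trans
      (G.reachable_stD_sideM_of_val m tf ε σ hv').symm
  · have key : ∀ w : (G.bigon m tf ε).Arc,
        (w.val = 2 * G.n + 1 ∨ w.val = m.val ∨ w.val = 2 * G.n + 3 ∨ w.val = 2 * G.n + 2 ∨
          w.val = m.val + 1 ∨ w.val = (if m.val = 0 then 2 * G.n + 3 else m.val - 1)) →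
        ((G.bigon m tf ε).stateGraph (G.stD m tf ε σ)).Reachable w (G.sideM m tf ε) := by
      intro w hw
      rcases hw with hw | hw | hw | hw | hw | hw
      · exact G.reachable_stD_sideM_of_val m tf ε σ (Or.inl hw)
      · exact G.reachable_stD_sideM_of_val m tf ε σ (Or.inr (Or.inl hw))
      · exact G.reachable_stD_sideM_of_val m tf ε σ (Or.inr (Or.inr hw))
      · exact (G.reachable_stD_sideE_of_val m tf ε σ (Or.inr (Or.inl hw))).trans
          (G.reachable_stD_sideM_sideE m tf ε σ hm).symm
      · exact (G.reachable_stD_sideE_of_val m tf ε σ (Or.inr (Or.inr hw))).trans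
          (G.reachable_stD_sideM_sideE m tf ε σ hm).symm
      · exact (G.reachable_stD_sideE_of_val m tf ε σ (Or.inl hw)).trans
          (G.reachable_stD_sideM_sideE m tf ε σ hm).symm
    exact (key u hu').trans (key v hv').symm

/-- **Reachability in `G` lifts to the oriented resolution of the bigon**, between any arcs with
the given projections. [folklore] -/
theorem reachable_stD_of_reachable {u₀ v₀ : G.Arc} (h : (G.stateGraph σ).Reachable u₀ v₀)
    {u v : (G.bigon m tf ε).Arc} (hu : G.projD m tf ε u = u₀) (hv : G.projD m tf ε v = v₀) :
    ((G.bigon m tf ε).stateGraph (G.stD m tf ε σ)).Reachable u v := by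
  obtain ⟨w⟩ := h
  induction w generalizing u with
  | nil => exact G.reachable_stD_of_projD_eq m tf ε σ (hu.trans hv.symm)
  | @cons a c _ hadj _ ih =>
    rw [stateGraph_adj] at hadj
    obtain ⟨-, q, hq⟩ := hadj
    have key : ∃ u' c', ((G.bigon m tf ε).stateGraph (G.stD m tf ε σ)).Reachable u' c' ∧
        G.projD m tf ε u' = a ∧ G.projD m tf ε c' = c := by
      rcases hq with hq | hq
      · obtain ⟨u', c', hg, h1, h2⟩ := G.exists_glueRel_bigon_of_glueRel m tf ε σ _ _ hq
        exact ⟨u', c', (G.bigon m tf ε).reachable_of_glueRel _ hg, h1, h2⟩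
      · obtain ⟨c', u', hg, h1, h2⟩ := G.exists_glueRel_bigon_of_glueRel m tf ε σ _ _ hq
        exact ⟨u', c', ((G.bigon m tf ε).reachable_of_glueRel _ hg).symm, h2, h1⟩
    obtain ⟨u', c', hr, h1, h2⟩ := key
    exact ((G.reachable_stD_of_projD_eq m tf ε σ (hu.trans h1.symm)).trans hr).trans (ih h2 hv)

/-- **State circles of the oriented resolution of the bigon are those of `G`**: two arcs lie on
one circle of `stD σ` iff their projections lie on one circle of `σ`. Khovanov (2000), §5.3
(`D_{01} = D`); Bar-Natan (2002), §4.3. [cite: Khovanov2000, §5.3] -/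
theorem circleOf_stD_eq_iff (u v : (G.bigon m tf ε).Arc) :
    (G.bigon m tf ε).circleOf (G.stD m tf ε σ) u = (G.bigon m tf ε).circleOf (G.stD m tf ε σ) v ↔
      G.circleOf σ (G.projD m tf ε u) = G.circleOf σ (G.projD m tf ε v) := by
  simp only [circleOf_eq_iff]
  exact ⟨G.reachable_projD_stD m tf ε σ, fun h ↦ G.reachable_stD_of_reachable m tf ε σ h rfl rfl⟩

/-- **The state circles of the oriented resolution, as a type, are those of `G`.** [folklore] -/
def stDCircleEquiv : (G.bigon m tf ε).StateCircle (G.stD m tf ε σ) ≃ G.StateCircle σ where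
  toFun := SimpleGraph.ConnectedComponent.lift (fun u ↦ G.circleOf σ (G.projD m tf ε u))
    (fun _ _ p _ ↦ circleOf_eq_iff.2 (G.reachable_projD_stD m tf ε σ ⟨p⟩))
  invFun := SimpleGraph.ConnectedComponent.lift
    (fun a ↦ (G.bigon m tf ε).circleOf (G.stD m tf ε σ) (G.liftD m tf ε a))
    (fun a b p _ ↦ circleOf_eq_iff.2
      (G.reachable_stD_of_reachable m tf ε σ ⟨p⟩ (G.projD_liftD m tf ε a) (G.projD_liftD m tf ε b)))
  left_inv C' := by
    induction C' using SimpleGraph.ConnectedComponent.ind with | h u => ?_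
    change (G.bigon m tf ε).circleOf _ (G.liftD m tf ε (G.projD m tf ε u)) =
      (G.bigon m tf ε).circleOf _ u
    exact circleOf_eq_iff.2 (G.reachable_stD_of_projD_eq m tf ε σ (G.projD_liftD m tf ε _))
  right_inv C := by
    induction C using SimpleGraph.ConnectedComponent.ind with | h a => ?_
    change G.circleOf σ (G.projD m tf ε (G.liftD m tf ε a)) = G.circleOf σ a
    rw [projD_liftD]

/-- `stDCircleEquiv` sends the circle of an arc to the circle of its projection. [folklore] -/
@[simp] theorem stDCircleEquiv_circleOf (u : (G.bigon m tf ε).Arc) :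
    G.stDCircleEquiv m tf ε σ ((G.bigon m tf ε).circleOf (G.stD m tf ε σ) u) =
      G.circleOf σ (G.projD m tf ε u) := rfl

end Reach

/-! ## Enhanced states over the oriented resolution -/

variable {G}

/-- **The enhanced state of the bigon over the oriented resolution with the labels of `s`**
(every arc labelled as its projection): the generator of `C(D_{01}) = C(D)` corresponding to the
generator `s` of `C(D)`. Khovanov (2000), §5.3; Bar-Natan (2002), §4.3. [cite: Khovanov2000, §5.3] -/
def bigonD (s : G.EnhancedState) : (G.bigon m tf ε).EnhancedState where
  state := G.stD m tf ε s.state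
  label u := s.label (G.projD m tf ε u)
  label_eq _ _ huv :=
    s.label_eq_of_reachable (G.reachable_projD_stD m tf ε s.state huv.reachable)

/-- The state of `bigonD s`. [folklore] -/
@[simp] theorem bigonD_state (s : G.EnhancedState) : (bigonD m tf ε s).state = G.stD m tf ε s.state :=
  rfl

/-- The labels of `bigonD s`. [folklore] -/
@[simp] theorem bigonD_label (s : G.EnhancedState) (u : (G.bigon m tf ε).Arc) :
    (bigonD m tf ε s).label u = s.label (G.projD m tf ε u) := rfl

/-- **The inverse construction**: from an enhanced state of the bigon over an oriented resolution,
the enhanced state of `G` with the labels read on the lifts. [folklore] -/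
def unbigonD (t : (G.bigon m tf ε).EnhancedState) {σ : G.State} (ht : t.state = G.stD m tf ε σ) :
    G.EnhancedState where
  state := σ
  label a := t.label (G.liftD m tf ε a)
  label_eq a b hab := by
    apply t.label_eq_of_reachable
    rw [ht]
    exact G.reachable_stD_of_reachable m tf ε σ hab.reachable (G.projD_liftD m tf ε a)
      (G.projD_liftD m tf ε b)

/-- `unbigonD` is a left inverse of `bigonD`. [folklore] -/
theorem unbigonD_bigonD (s : G.EnhancedState) : unbigonD m tf ε (bigonD m tf ε s) rfl = s :=
  EnhancedState.ext' rfl (funext fun a ↦ by simp [unbigonD])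

/-- `bigonD` is a left inverse of `unbigonD`: **every enhanced state over an oriented resolution
is a `bigonD`**. [folklore] -/
theorem bigonD_unbigonD (t : (G.bigon m tf ε).EnhancedState) {σ : G.State}
    (ht : t.state = G.stD m tf ε σ) : bigonD m tf ε (unbigonD m tf ε t ht) = t := by
  refine EnhancedState.ext' ht.symm (funext fun u ↦ ?_)
  show t.label (G.liftD m tf ε (G.projD m tf ε u)) = t.label u
  apply t.label_eq_of_reachable
  rw [ht]
  exact G.reachable_stD_of_projD_eq m tf ε σ (G.projD_liftD m tf ε _)

/-- Every enhanced state over an oriented resolution is a `bigonD`. [folklore] -/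
theorem eq_bigonD_of_state_eq (t : (G.bigon m tf ε).EnhancedState) {σ : G.State}
    (ht : t.state = G.stD m tf ε σ) : ∃ s : G.EnhancedState, s.state = σ ∧ bigonD m tf ε s = t :=
  ⟨unbigonD m tf ε t ht, rfl, bigonD_unbigonD m tf ε t ht⟩

/-- `bigonD` is injective. [folklore] -/
theorem bigonD_injective : Injective (bigonD m tf ε (G := G)) := fun s s' h ↦ by
  have hst : s.state = s'.state :=
    (G.bigonState_inj m tf ε (congrArg EnhancedState.state h :)).1
  refine EnhancedState.ext' hst (funext fun a ↦ ?_)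
  have := congrArg (fun t : (G.bigon m tf ε).EnhancedState ↦ t.label (G.liftD m tf ε a)) h
  simpa using this

/-- `bigonD` is injective, as an iff. [folklore] -/
@[simp] theorem bigonD_eq_iff {s s' : G.EnhancedState} : bigonD m tf ε s = bigonD m tf ε s' ↔ s = s' :=
  (bigonD_injective m tf ε).eq_iff

/-! ## Merges, splits and incidence numbers over the oriented resolution -/

/-- The first local strand of an old chord in the bigon projects to the old first strand.
[folklore] -/
theorem projD_arcIn_overPos_oldC (i : Fin G.n) :
    G.projD m tf ε ((G.bigon m tf ε).arcIn ((G.bigon m tf ε).overPos (G.oldC m tf ε i))) =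
      G.arcIn (G.overPos i) := by
  rw [overPos_bigon_oldC, projD_arcIn_bEmb]

/-- The second local strand of an old chord in the bigon projects to the old second strand.
[folklore] -/
theorem projD_arcOut_overPos_oldC (i : Fin G.n) :
    G.projD m tf ε ((G.bigon m tf ε).arcOut ((G.bigon m tf ε).overPos (G.oldC m tf ε i))) =
      G.arcOut (G.overPos i) := by
  rw [overPos_bigon_oldC, projD_arcOut_bEmb]

/-- Flipping an old chord of an oriented resolution gives an oriented resolution. [folklore] -/
theorem update_stD_oldC (σ : G.State) (i : Fin G.n) (c : Bool) :
    Function.update (G.stD m tf ε σ) (G.oldC m tf ε i) c = G.stD m tf ε (Function.update σ i c) :=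
  G.update_bigonState_oldC m tf ε σ _ _ i c

/-- An oriented resolution at an old chord. [folklore] -/
@[simp] theorem stD_oldC (σ : G.State) (i : Fin G.n) : G.stD m tf ε σ (G.oldC m tf ε i) = σ i :=
  G.bigonState_oldC m tf ε σ _ _ i

/-- **An old chord is a merge in the oriented resolution of the bigon iff it is a merge in `G`.**
[folklore] -/
theorem isMergeAt_stD_oldC_iff (σ : G.State) (i : Fin G.n) :
    (G.bigon m tf ε).IsMergeAt (G.stD m tf ε σ) (G.oldC m tf ε i) ↔ G.IsMergeAt σ i := by
  unfold IsMergeAt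
  rw [stD_oldC, Ne, circleOf_stD_eq_iff, projD_arcIn_overPos_oldC, projD_arcOut_overPos_oldC]

/-- **An old chord is a split in the oriented resolution of the bigon iff it is a split in `G`.**
[folklore] -/
theorem isSplitAt_stD_oldC_iff (σ : G.State) (i : Fin G.n) :
    (G.bigon m tf ε).IsSplitAt (G.stD m tf ε σ) (G.oldC m tf ε i) ↔ G.IsSplitAt σ i := by
  unfold IsSplitAt
  rw [stD_oldC, update_stD_oldC, Ne, circleOf_stD_eq_iff, projD_arcIn_overPos_oldC,
    projD_arcOut_overPos_oldC]

/-- The agreement clause of the incidence number, transported along the projection. [folklore] -/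
theorem forall_label_stD_iff (s s' : G.EnhancedState) (τ : G.State) (a : G.Arc)
    (a' : (G.bigon m tf ε).Arc) (ha : G.projD m tf ε a' = a) :
    (∀ c, (G.bigon m tf ε).circleOf (G.stD m tf ε τ) c ≠
        (G.bigon m tf ε).circleOf (G.stD m tf ε τ) a' →
        s'.label (G.projD m tf ε c) = s.label (G.projD m tf ε c)) ↔
      ∀ c, G.circleOf τ c ≠ G.circleOf τ a → s'.label c = s.label c := by
  constructor
  · intro H c hc
    have := H (G.liftD m tf ε c) (by rw [Ne, circleOf_stD_eq_iff, projD_liftD, ha]; exact hc)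
    simpa using this
  · intro H c hc
    exact H _ (by rw [Ne, circleOf_stD_eq_iff, ha] at hc; exact hc)

/-- The Koszul sign of an old chord in an oriented resolution. [folklore] -/
theorem edgeSign_stD_oldC (σ : G.State) (i : Fin G.n) :
    edgeSign (G.stD m tf ε σ) (G.oldC m tf ε i) = edgeSign σ i :=
  G.edgeSign_bigonState_oldC m tf ε σ _ _ i

section Ring

variable {R : Type} [CommRing R] (hR tR : R)

/-- **The differential of the bigon restricted to the oriented resolutions is the differential of
`G`**: `⟨d (bigonD s), bigonD s'⟩ = ⟨d s, s'⟩` — old chords are merges/splits in the oriented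
resolution exactly when they are in `G`, with the same local strands, the same labels and the
same Koszul signs. Khovanov (2000), §5.3 (`C(D_{01}) = C(D)`); Bar-Natan (2002), §4.3.
[cite: Khovanov2000, §5.3] -/
theorem incidence_bigonD (s s' : G.EnhancedState) :
    (G.bigon m tf ε).incidence R hR tR (bigonD m tf ε s) (bigonD m tf ε s') =
      G.incidence R hR tR s s' := by
  by_cases hfl : ∃ i, s.state i = false ∧ s'.state = Function.update s.state i true
  · obtain ⟨i, hi, hs'⟩ := hfl
    have hi' : (bigonD m tf ε s).state (G.oldC m tf ε i) = false := by simpa using hi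
    have hs'' : (bigonD m tf ε s').state =
        Function.update (bigonD m tf ε s).state (G.oldC m tf ε i) true := by
      simp only [bigonD_state, update_stD_oldC, hs']
    rw [(G.bigon m tf ε).incidence_of_flip R hR tR hi' hs'', G.incidence_of_flip R hR tR hi hs']
    have e1 := forall_label_stD_iff m tf ε s s' s'.state (G.arcIn (G.overPos i)) _
      (projD_arcIn_overPos_oldC m tf ε i)
    have e2 := forall_label_stD_iff m tf ε s s' s.state (G.arcIn (G.overPos i)) _
      (projD_arcIn_overPos_oldC m tf ε i)
    simp only [bigonD_state, isMergeAt_stD_oldC_iff, isSplitAt_stD_oldC_iff, edgeSign_stD_oldC,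
      bigonD_label, projD_arcIn_overPos_oldC, projD_arcOut_overPos_oldC, e1, e2]
  · rw [G.incidence_of_not_flip R hR tR hfl, (G.bigon m tf ε).incidence_of_not_flip R hR tR]
    rintro ⟨j, hj, hj'⟩
    apply hfl
    rcases G.eq_oldC_or_bX_or_bY m tf ε j with ⟨i, rfl⟩ | rfl | rfl
    · refine ⟨i, by simpa using hj, ?_⟩
      simp only [bigonD_state, update_stD_oldC] at hj'
      exact (G.bigonState_inj m tf ε hj').1
    · simp only [bigonD_state, stD, update_bigonState_bX] at hj'
      have := (G.bigonState_inj m tf ε hj').2.1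
      simp only [bigonD_state, stD, bigonState_bX] at hj
      rw [hj] at this
      exact (Bool.false_ne_true this).elim
    · simp only [bigonD_state, stD, update_bigonState_bY] at hj'
      have := (G.bigonState_inj m tf ε hj').2.2
      simp only [bigonD_state, stD, bigonState_bY] at hj
      rw [hj] at this
      exact (Bool.false_ne_true this).elim

end Ring

/-! ## Degrees -/

/-- The weight of an oriented resolution: one of the two new chords is `1`-smoothed. [folklore] -/
theorem weight_stD (σ : G.State) : (G.stD m tf ε σ).weight = σ.weight + 1 := by
  unfold stD oBitX oBitY
  rw [weight_bigonState]
  rcases Int.units_eq_one_or ε with rfl | rfl <;> simp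

/-- **`bigonD` preserves the homological degree** (`|s| + 1` and `n₋ + 1`). Khovanov (2000), §5.3.
[cite: Khovanov2000, §5.3] -/
theorem homDegree_bigonD (s : G.EnhancedState) : homDegree (bigonD m tf ε s) = homDegree s := by
  simp only [homDegree, bigonD_state, weight_stD, nMinus_bigon]
  push_cast
  ring

/-- The labels of the circles of `bigonD s` are those of `s`. [folklore] -/
theorem circleLabel_bigonD (s : G.EnhancedState)
    (C' : (G.bigon m tf ε).StateCircle (bigonD m tf ε s).state) :
    circleLabel (bigonD m tf ε s) C' = circleLabel s (G.stDCircleEquiv m tf ε s.state C') := by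
  induction C' using SimpleGraph.ConnectedComponent.ind with | h u => ?_
  rfl

/-- **`bigonD` preserves the quantum degree** (the labelled circles correspond; `|s| + 1`,
`n₊ + 1`, `n₋ + 1`). Khovanov (2000), §5.3. [cite: Khovanov2000, §5.3] -/
theorem qDegree_bigonD (s : G.EnhancedState) : qDegree (bigonD m tf ε s) = qDegree s := by
  have hsum : ∑ C', labelDeg (circleLabel (bigonD m tf ε s) C') = ∑ C, labelDeg (circleLabel s C) :=
    Fintype.sum_equiv (G.stDCircleEquiv m tf ε s.state) _ _ (fun C' ↦ by rw [circleLabel_bigonD])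
  rw [qDegree_eq_sum_circleLabel, qDegree_eq_sum_circleLabel, hsum]
  simp only [bigonD_state, weight_stD, nPlus_bigon, nMinus_bigon]
  push_cast
  ring

end GaussDiagram

end Literature.Topology.FourManifolds
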